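import Summits.QuantumFields.YangMills.Theorems.FemtoTransferGapReduction

/-!
# Femto transfer gap — one-site SCALING is a corollary of `OneSiteLevels`

Support module for route `LuscherReduction` (QuantumFields / YangMills; rung leaf `FemtoGapOfRecord`), crux `RunningReduction`
(item `stmt-QuantumFields-19978`).  The registered birth skeleton v5 of `RunningReduction` (sha16 08ff0e180657a458) composes, along its
renormalisation-group line, `T1 FemtoBlocking → T2 OneSiteScaling → S3 TransferValuesNonneg → S4 OneSiteTopPos → RunningReduction`.
This file proves that **T2 is not an independent difficulty**: the one-site law is LINEAR in the bare running parameter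
`λ_b = (2/b)^{1/3}` — `L` steps of the one-site transfer operator at coupling `L³b` (`λ_b(L³b) = λ_b(b)/L`) match ONE step at coupling `b`
at the level of every min-max value, to relative precision `e^{±Cλ_b(b)²}`:
`μ_k(L³b)^L · μ₀(b) ≤ e^{Cλ_b²} · μ_k(b) · μ₀(L³b)^L` and `μ_k(b) · μ₀(L³b)^L ≤ e^{Cλ_b²} · μ_k(L³b)^L · μ₀(b)` for `b ≥ B₀`, all `L ≥ 1` —
from the two-sided one-site level asymptotics `OneSiteLevels` (the route's OTHER crux, item `stmt-QuantumFields-20007`) at `b` and at `L³b`: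
raise the bound at `L³b` to the `L`-th power (the `Δ_k λ_b` terms cancel exactly), constant `2|C|`.
Consequently the RG line for `RunningReduction` reduces to `T1 FemtoBlocking` given `OneSiteLevels` (and the elementary `S3`, `S4`).

The conclusion of `oneSiteScaling_of_oneSiteLevels` below is VERBATIM the registered stub statement `Stmt.stub_oneSiteScaling`
(= `OneSiteScaling` of the skeleton), so `theorem stub_oneSiteScaling : Stmt.stub_oneSiteScaling := oneSiteScaling_of_oneSiteLevels h`
discharges it under `h : OneSiteLevels` (the route item `Theses.LuscherReduction.OneSiteLevels` is rfl-equal to the tree decl used here).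

WHAT THIS IS NOT: not a proof of `OneSiteLevels`, not a statement about Yang–Mills beyond the one-site model, NOT THE CLAY GAP.
No `sorry`, no new axioms.  (Authored by the route owner, planner ym-beyond-p1 g14, 2026-08-26, as an extract of the registered skeleton;
to be filed by a prover `--supports stmt-QuantumFields-19978 --as helper`.)
-/

set_option autoImplicit false

noncomputable section

open Real
open Literature.MathematicalPhysics.QuantumFieldTheory
open Literature.MathematicalPhysics.QuantumLattice
open Literature.Analysis.OperatorTheory.YMMatrixModel

namespace Summit.QuantumFields.YangMills.Theorems.FemtoTransferGap

/-- `λ_b(L³ b) = λ_b(b) / L` for the bare running parameter `λ_b = (2/b)^{1/3}`. [folklore] -/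
theorem bareLambda_cube_mul {b : ℝ} (hb : 0 < b) (L : ℕ) [NeZero L] : bareLambda ((L : ℝ) ^ 3 * b) = bareLambda b / L := by
  have hL : (0 : ℝ) < L := Nat.cast_pos.mpr (NeZero.pos L)
  unfold bareLambda
  have h13 : ((1 : ℝ) / 3) = ((3 : ℕ) : ℝ)⁻¹ := by norm_num
  rw [h13, mul_comm, ← div_div, Real.div_rpow (by positivity) (by positivity),
    Real.pow_rpow_inv_natCast hL.le (by norm_num)]


/-- `e^{-a} u ≤ v ⇒ u ≤ e^{a} v`. [folklore] -/
theorem le_exp_mul_of_exp_neg_mul_le {a u v : ℝ} (h : Real.exp (-a) * u ≤ v) : u ≤ Real.exp a * v := by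
  have := mul_le_mul_of_nonneg_left h (Real.exp_pos a).le
  rwa [← mul_assoc, ← Real.exp_add, add_neg_cancel, Real.exp_zero, one_mul] at this


/-- **`OneSiteLevels → OneSiteScaling`.**  ONE at `b` and at `L³b` (`λ_b(L³b) = λ_b(b)/L`): `μ_k(L³b)^L ≤ e^{−(Δ_kλ_b − Cλ_b²/L)} μ₀(L³b)^L`,
`μ₀(b) ≤ e^{Δ_kλ_b + Cλ_b²} μ_k(b)`, multiply (the `Δ_kλ_b` cancel) — and symmetrically; constant `2|C|`. -/
theorem oneSiteScaling_of_oneSiteLevels (h : OneSiteLevels) :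
    ∀ k : ℕ, ∃ C B0 : ℝ, ∀ (L : ℕ) [NeZero L] (b : ℝ), B0 ≤ b →
      levelValue su2Rep 1 ((L : ℝ) ^ 3 * b) k ^ L * levelValue su2Rep 1 b 0 ≤
          Real.exp (C * bareLambda b ^ 2) * (levelValue su2Rep 1 b k * levelValue su2Rep 1 ((L : ℝ) ^ 3 * b) 0 ^ L) ∧
        levelValue su2Rep 1 b k * levelValue su2Rep 1 ((L : ℝ) ^ 3 * b) 0 ^ L ≤
          Real.exp (C * bareLambda b ^ 2) * (levelValue su2Rep 1 ((L : ℝ) ^ 3 * b) k ^ L * levelValue su2Rep 1 b 0) := by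
  intro k
  obtain ⟨C, B0, H⟩ := h k
  refine ⟨2 * |C|, max B0 1, ?_⟩
  intro L _ b hb
  have hb1 : 1 ≤ b := (le_max_right _ _).trans hb
  have hbB0 : B0 ≤ b := (le_max_left _ _).trans hb
  have hb0 : 0 < b := by linarith
  have hLpos : (0 : ℝ) < L := Nat.cast_pos.mpr (NeZero.pos L)
  have hL1 : (1 : ℝ) ≤ L := by exact_mod_cast NeZero.one_le
  have hL3 : (1 : ℝ) ≤ (L : ℝ) ^ 3 := one_le_pow₀ hL1
  have hBb : b ≤ (L : ℝ) ^ 3 * b := le_mul_of_one_le_left hb0.le hL3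
  have hBB0 : B0 ≤ (L : ℝ) ^ 3 * b := hbB0.trans hBb
  have hlamB : bareLambda ((L : ℝ) ^ 3 * b) = bareLambda b / L := bareLambda_cube_mul hb0 L
  obtain ⟨hy0, hUb, hLb⟩ := H b hbB0
  obtain ⟨hz0, hUB, hLB⟩ := H ((L : ℝ) ^ 3 * b) hBB0
  rw [hlamB] at hUB hLB
  set t : ℝ := bareLambda b with ht_def
  set Δ : ℝ := levelGap k with hΔ_def
  set yk := levelValue su2Rep 1 b k with hyk_def
  set y0 := levelValue su2Rep 1 b 0 with hy0_def
  set zk := levelValue su2Rep 1 ((L : ℝ) ^ 3 * b) k with hzk_def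
  set z0 := levelValue su2Rep 1 ((L : ℝ) ^ 3 * b) 0 with hz0_def
  have hzk : 0 ≤ zk := le_trans (mul_nonneg (Real.exp_pos _).le hz0.le) hLB
  have hyk : 0 ≤ yk := le_trans (mul_nonneg (Real.exp_pos _).le hy0.le) hLb
  -- exponent bookkeeping
  have hc1 : C * t ^ 2 / L ≤ |C| * t ^ 2 := by
    have h1 : C * t ^ 2 / L ≤ |C| * t ^ 2 / L :=
      div_le_div_of_nonneg_right (mul_le_mul_of_nonneg_right (le_abs_self C) (sq_nonneg t)) hLpos.le
    exact h1.trans (div_le_self (mul_nonneg (abs_nonneg C) (sq_nonneg t)) hL1)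
  have hc2 : C * t ^ 2 ≤ |C| * t ^ 2 := mul_le_mul_of_nonneg_right (le_abs_self C) (sq_nonneg t)
  have hA : (L : ℝ) * -(Δ * (t / L) - C * (t / L) ^ 2) = -(Δ * t) + C * t ^ 2 / L := by
    field_simp; ring
  have hB : (L : ℝ) * (Δ * (t / L) + C * (t / L) ^ 2) = Δ * t + C * t ^ 2 / L := by
    field_simp
  have hE1 : (L : ℝ) * -(Δ * (t / L) - C * (t / L) ^ 2) + (Δ * t + C * t ^ 2) ≤ 2 * |C| * t ^ 2 := by rw [hA]; linarith
  have hE2 : -(Δ * t - C * t ^ 2) + (L : ℝ) * (Δ * (t / L) + C * (t / L) ^ 2) ≤ 2 * |C| * t ^ 2 := by rw [hB]; linarith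
  refine ⟨?_, ?_⟩
  · -- μ_k(L³b)^L μ₀(b) ≤ e^{2|C|t²} μ_k(b) μ₀(L³b)^L
    have h1 : zk ^ L ≤ Real.exp ((L : ℝ) * -(Δ * (t / L) - C * (t / L) ^ 2)) * z0 ^ L := by
      have := pow_le_pow_left₀ hzk hUB L
      rwa [mul_pow, ← Real.exp_nat_mul] at this
    have h2 : y0 ≤ Real.exp (Δ * t + C * t ^ 2) * yk := le_exp_mul_of_exp_neg_mul_le hLb
    calc zk ^ L * y0 ≤ (Real.exp ((L : ℝ) * -(Δ * (t / L) - C * (t / L) ^ 2)) * z0 ^ L) * (Real.exp (Δ * t + C * t ^ 2) * yk) :=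
          mul_le_mul h1 h2 hy0.le (mul_nonneg (Real.exp_pos _).le (pow_nonneg hz0.le L))
      _ = Real.exp ((L : ℝ) * -(Δ * (t / L) - C * (t / L) ^ 2) + (Δ * t + C * t ^ 2)) * (yk * z0 ^ L) := by
          conv_rhs => rw [Real.exp_add]
          ring
      _ ≤ Real.exp (2 * |C| * t ^ 2) * (yk * z0 ^ L) :=
          mul_le_mul_of_nonneg_right (Real.exp_le_exp.mpr hE1) (mul_nonneg hyk (pow_nonneg hz0.le L))
  · -- μ_k(b) μ₀(L³b)^L ≤ e^{2|C|t²} μ_k(L³b)^L μ₀(b)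
    have h3 : yk ≤ Real.exp (-(Δ * t - C * t ^ 2)) * y0 := hUb
    have h4 : z0 ^ L ≤ Real.exp ((L : ℝ) * (Δ * (t / L) + C * (t / L) ^ 2)) * zk ^ L := by
      have h := pow_le_pow_left₀ (mul_nonneg (Real.exp_pos _).le hz0.le) hLB L
      rw [mul_pow, ← Real.exp_nat_mul, mul_neg] at h
      exact le_exp_mul_of_exp_neg_mul_le h
    calc yk * z0 ^ L ≤ (Real.exp (-(Δ * t - C * t ^ 2)) * y0) * (Real.exp ((L : ℝ) * (Δ * (t / L) + C * (t / L) ^ 2)) * zk ^ L) :=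
          mul_le_mul h3 h4 (pow_nonneg hz0.le L) (mul_nonneg (Real.exp_pos _).le hy0.le)
      _ = Real.exp (-(Δ * t - C * t ^ 2) + (L : ℝ) * (Δ * (t / L) + C * (t / L) ^ 2)) * (zk ^ L * y0) := by
          conv_rhs => rw [Real.exp_add]
          ring
      _ ≤ Real.exp (2 * |C| * t ^ 2) * (zk ^ L * y0) :=
          mul_le_mul_of_nonneg_right (Real.exp_le_exp.mpr hE2) (mul_nonneg (pow_nonneg hzk L) hy0.le)

end Summit.QuantumFields.YangMills.Theorems.FemtoTransferGap

end
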